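import Mathlib

/-!
# Sketch — crux-ideate stmt-ValiantsHypothesis-15535 (`ValuativeGCT.HeadFlip`), ideator 2, round 1
Idea `identity-jet-ladder`: y₄-adic jet filtration of the four-variable permanental tangent span,
anchored at `A₄ = 1`, and the ternary bordering lemma.  First lemmas as elaborating signatures.
-/

set_option linter.dupNamespace false

namespace Summit.ValiantsHypothesis.ValiantsHypothesis.Cruxes.HeadFlip.IdentityJetLadder

open MvPolynomial
open scoped BigOperators

noncomputable section

/-- The `(i,j)` permanental minor of a square matrix over a commutative ring: permanent of the matrix with
row `i` and column `j` deleted. -/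
def perMinor {R : Type*} [CommRing R] {n : ℕ} (L : Matrix (Fin (n + 1)) (Fin (n + 1)) R)
    (i j : Fin (n + 1)) : R :=
  (L.submatrix (Fin.succAbove i) (Fin.succAbove j)).permanent

/-- The linear pencil `M(y) = Σ_t y_t A_t` of four `(n+1) × (n+1)` complex matrices, as a matrix of linear
forms in `ℂ[y₀, y₁, y₂, y₃]`. -/
def pencil {n : ℕ} (A : Fin 4 → Matrix (Fin (n + 1)) (Fin (n + 1)) ℂ) :
    Matrix (Fin (n + 1)) (Fin (n + 1)) (MvPolynomial (Fin 4) ℂ) :=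
  fun i j => ∑ t : Fin 4, C (A t i j) * X t

/-- The four-row TANGENT SPAN `S(A) = span{ y_t · Per_ij(M(y)) } ⊂ Sym^{n+1} ℂ⁴` — the m-free object of
`stub_fourRowPencilRank` (its dimension + 3 is the dimension of the per side `P_{m,4}` of line four-row-count). -/
def tangentSpan {n : ℕ} (A : Fin 4 → Matrix (Fin (n + 1)) (Fin (n + 1)) ℂ) :
    Submodule ℂ (MvPolynomial (Fin 4) ℂ) :=
  Submodule.span ℂ (Set.range fun tij : Fin 4 × Fin (n + 1) × Fin (n + 1) =>
    X tij.1 * perMinor (pencil A) tij.2.1 tij.2.2)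

/-- The `a`-th JET LEVEL along the hyperplane `y₃ = 0`: elements of the tangent span divisible by `y₃ ^ a`.
`jetLevel A 0 = tangentSpan A`, the levels decrease, and the graded piece `level a / level (a+1)` embeds in
`y₃^a · Sym^{n+1-a} ℂ[y₀,y₁,y₂]`, of dimension `C(n+3-a, 2)`. -/
def jetLevel {n : ℕ} (A : Fin 4 → Matrix (Fin (n + 1)) (Fin (n + 1)) ℂ) (a : ℕ) :
    Submodule ℂ (MvPolynomial (Fin 4) ℂ) :=
  tangentSpan A ⊓ (Ideal.span {(X 3 : MvPolynomial (Fin 4) ℂ) ^ a}).restrictScalars ℂ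

/-- Graded dimension of the `a`-th jet level. -/
def grJet {n : ℕ} (A : Fin 4 → Matrix (Fin (n + 1)) (Fin (n + 1)) ℂ) (a : ℕ) : ℕ :=
  Module.finrank ℂ ↥(jetLevel A a) - Module.finrank ℂ ↥(jetLevel A (a + 1))

/-- FIRST LEMMA (a): TERNARY BORDERING.  For every `n` there is an UPPER-TRIANGULAR `(n+1) × (n+1)` matrix of
ternary linear forms whose `n × n` permanental minors span ALL ternary forms of degree `n`
(induction on `n` by bordering `[[L, b], [0, ℓ]]`: the new minors are `ℓ · (old minors)`, `per L = ∏ ℓ_i` and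
`Σ_k b_k Per_kj(L)`; independence modulo `ℓ` by evaluation at the roots of the restricted diagonal forms).
Numerics: full rank `C(n+2,2)` for random triangular pencils, n ≤ 8, per AND det (compute/ternary.py). -/
def TernaryBordering : Prop :=
  ∀ n : ℕ, ∃ L : Matrix (Fin (n + 1)) (Fin (n + 1)) (MvPolynomial (Fin 3) ℂ),
    (∀ i j, (L i j).IsHomogeneous 1) ∧ (∀ i j, j < i → L i j = 0) ∧
      Submodule.span ℂ (Set.range fun ij : Fin (n + 1) × Fin (n + 1) => perMinor L ij.1 ij.2) =
        MvPolynomial.homogeneousSubmodule (Fin 3) ℂ n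

/-- FIRST LEMMA (b): UNIVERSAL JET LEVELS.  For all large `n` some pencil with `A₃ = 1` (identity anchor:
`Per_ij(N + y₃·1) = Σ_H y₃^{|H|} Per_ij(N[Hᶜ])`, so level-`a` jets are minor spans of principal ternary
sub-pencils) has FULL jet levels `a = 0, 1, 2, 3`: `gr_a = C(n+3-a, 2)`.  Their sum is `2(n+1)² + 2`, the
Gulliksen–Negård / Beauville count of the DETERMINANTAL analogue, for which levels `≥ 4` are EMPTY
(numerics n ≤ 17, exact n ≤ 7: det `gr = (C(n+3,2), C(n+2,2), C(n+1,2), C(n,2), 0, 0, …)`). -/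
def UniversalJetLevels : Prop :=
  ∃ n₀ : ℕ, ∀ n ≥ n₀, ∃ N : Fin 3 → Matrix (Fin (n + 1)) (Fin (n + 1)) ℂ,
    ∀ a ≤ 3, grJet (Fin.snoc N 1) a = Nat.choose (n + 3 - a) 2

/-- THE PER-SPECIFIC STEP (crux content of the idea): a FOURTH-JET SURPLUS of positive density — for some
`c` and all large `n`, some identity-anchored pencil has `dim gr_4 ≥ (n+1)²/c` on top of full universal levels.
(Numerics: `gr_4 = C(n-1,2)`, i.e. FULL, at every n ≤ 17 computed; for det it is 0 identically.) -/
def FourthJetSurplus (c : ℕ) : Prop :=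
  ∃ n₀ : ℕ, ∀ n ≥ n₀, ∃ N : Fin 3 → Matrix (Fin (n + 1)) (Fin (n + 1)) ℂ,
    (∀ a ≤ 3, grJet (Fin.snoc N 1) a = Nat.choose (n + 3 - a) 2) ∧
      (n + 1) ^ 2 ≤ c * grJet (Fin.snoc N 1) 4

/-- TRANSFER TARGET: a per-side four-row rank of `(2 + 1/c)·(n+1)² + O(n)`, which is the hypothesis of the
line's `stub_fourRowPencilRank` at slope `√(1 + 1/(2c)) > 1` (hence `HeadFlip` with `(a,b)` chosen from `c`,
through the registered glue `headFlipBody_of` re-instantiated at that slope).  The implication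
`FourthJetSurplus c → FourRowRankFrom c` is the filtration identity `dim S = Σ_a gr_a ≥ Σ_{a ≤ 4} gr_a`. -/
def FourRowRankFrom (c : ℕ) : Prop :=
  ∃ n₀ : ℕ, ∀ n ≥ n₀, ∃ A : Fin 4 → Matrix (Fin (n + 1)) (Fin (n + 1)) ℂ,
    c * (2 * (n + 1) ^ 2 + 2) + (n + 1) ^ 2 ≤ c * Module.finrank ℂ ↥(tangentSpan A)

/-- Filtration bookkeeping (pure linear algebra; the first thing a line would land). -/
theorem fourRowRank_of_fourthJetSurplus (c : ℕ) (hc : 0 < c) :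
    FourthJetSurplus c → FourRowRankFrom c := by
  sorry

end

end Summit.ValiantsHypothesis.ValiantsHypothesis.Cruxes.HeadFlip.IdentityJetLadder
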